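import Mathlib
import Summits.ResolutionOfSingularities.ResolutionOfSingularities.Theorems.WeightedInvariantDatumToEmbeddedQuotientSingularitiesGradedLocalization
import Summits.ResolutionOfSingularities.ResolutionOfSingularities.Theorems.WeightedInvariantDatumToEmbeddedQuotientSingularitiesSliceSmooth
import HarnessLib

/-!
# Slice theorem, step 3: the invariant basic open `S[1/s₀]` of the slice

Topic: `Summits/ResolutionOfSingularities/ResolutionOfSingularities/Theorems`. Helper file of the
stub `stub_qs_sliceCore` of the line `Sketch` of the crux
`Theses.WeightedInvariant.DatumToEmbedded` (statement `stmt-ResolutionOfSingularities-0572`).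

Setting of `…QuotientSingularitiesSlice` / `…SliceSmooth`: the slice `S = Slice k π u` graded by
`A = G ⧸ M` (`slicePiece`), its base point `sliceEval : S → κ`, and a degree-`0` element
`s₀ ∈ S₀` not vanishing at the base point. The localisation `S' = S[1/s₀]` is graded by `A`
(`awayPiece`, sibling file `…QuotientSingularitiesGradedLocalization`) with `S'₀ = S₀[1/s₀]`, and:

* `sliceAwayZeroAlgebra` — `S'₀` as an `R₀`-algebra through `R₀ → S₀ ≅ R₀ ⊗ₖ κ → S'₀`
  (`zeroAlgebra` of `…SliceZero` followed by the localisation map), compatible with `k`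
  (`isScalarTower_sliceAway`) and **étale** when `κ` is étale over `k` (`etale_sliceAway`:
  `R₀ ⊗ₖ κ` is étale over `R₀`, a localisation is étale);
* `sliceAwayEval : S' → κ` (the base point survives in `D(s₀)`), the prime
  `sliceAwayPrime = ker (S'₀ → S' → κ)` of `S'₀`, and
  `algebraMap_mem_sliceAwayPrime_iff : (r ↦ S'₀) ∈ sliceAwayPrime ↔ π r = 0` for `r ∈ R₀` — the
  prime lies over the image of the closed point in the quotient `Spec R₀`.

Only Mathlib and the sibling helper files are used. [folklore: Luna's étale slice theorem for
diagonalizable groups, Zariski form]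
-/

-- the summit namespace repeats `ResolutionOfSingularities` by design (mandated namespace)
set_option linter.dupNamespace false

namespace Summit.ResolutionOfSingularities.ResolutionOfSingularities.Theorems.DatumToEmbedded.QuotientSingularities

open DirectSum TensorProduct Literature.RingTheory.GradedAlgebra

section Setting

variable {k : Type} [Field k] {R : Type} [CommRing R] [Algebra k R]
  {G : Type} [AddCommGroup G] [DecidableEq G] (𝓡 : G → Submodule k R) [GradedAlgebra 𝓡]
  {κ : Type} [Field κ] [Algebra k κ] (π : R →ₐ[k] κ) (M : Submodule ℤ G)
  {m : ℕ} (b : Module.Basis (Fin m) ℤ M) (u : Fin m → R)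
  (hu : ∀ l, u l ∈ 𝓡 (b l)) (hunit : ∀ l, IsUnit (u l)) [DecidableEq (G ⧸ M)]
  (s₀ : Slice k π u) (hs₀ : s₀ ∈ slicePiece k 𝓡 π M b u hu 0)

/-! ## The grading of `S[1/s₀]` -/

/-- **The grading of `S' = S[1/s₀]`** by `A = G ⧸ M` (`s₀ ∈ S₀`): `S'_a = S_a[1/s₀]`.
[folklore] -/
noncomputable abbrev sliceAwayPiece : G ⧸ M → Submodule k (Localization.Away s₀) :=
  awayPiece (slicePiece k 𝓡 π M b u hu) hs₀ (Localization.Away s₀)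

/-- The pieces of `S[1/s₀]` form a grading. [folklore] -/
noncomputable instance sliceAwayPiece.gradedAlgebra :
    GradedAlgebra (sliceAwayPiece 𝓡 π M b u hu s₀ hs₀) :=
  Classical.choice (nonempty_gradedAlgebra_awayPiece _ hs₀ _)

/-! ## `S'₀` as an `R₀`-algebra -/

/-- **`S'₀` as an `R₀`-algebra**: `R₀ → S₀ → S'₀ = S₀[1/s₀]`. [folklore] -/
@[reducible] noncomputable def sliceAwayZeroAlgebra :
    Algebra (𝓡 0) (sliceAwayPiece 𝓡 π M b u hu s₀ hs₀ 0) :=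
  ((awayPieceZeroHom (slicePiece k 𝓡 π M b u hu) hs₀ (Localization.Away s₀)).comp
    (letI := zeroAlgebra 𝓡 π M b u hu
     algebraMap (𝓡 0) (slicePiece k 𝓡 π M b u hu 0))).toAlgebra

/-- The structure map `R₀ → S'₀` followed by `S'₀ ⊆ S'` is `r ↦ (1 ⊗ r)‾ / 1`. [folklore] -/
theorem coe_algebraMap_sliceAway (r : 𝓡 0) :
    letI := sliceAwayZeroAlgebra 𝓡 π M b u hu s₀ hs₀
    (algebraMap (𝓡 0) (sliceAwayPiece 𝓡 π M b u hu s₀ hs₀ 0) r : Localization.Away s₀) =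
      algebraMap (Slice k π u) (Localization.Away s₀) (toSlice k π u r) := by
  rw [← coe_algebraMap_zero 𝓡 π M b u hu r]
  rfl

/-- `k → R₀ → S'₀` is the structure map of `S'₀`. [folklore] -/
theorem isScalarTower_sliceAway :
    letI := sliceAwayZeroAlgebra 𝓡 π M b u hu s₀ hs₀
    IsScalarTower k (𝓡 0) (sliceAwayPiece 𝓡 π M b u hu s₀ hs₀ 0) := by
  letI := sliceAwayZeroAlgebra 𝓡 π M b u hu s₀ hs₀
  refine IsScalarTower.of_algebraMap_eq (R := k) (S := 𝓡 0)
    (A := sliceAwayPiece 𝓡 π M b u hu s₀ hs₀ 0) fun c => Subtype.ext ?_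
  rw [SetLike.GradeZero.coe_algebraMap, coe_algebraMap_sliceAway,
    IsScalarTower.algebraMap_apply k (Slice k π u) (Localization.Away s₀)]
  congr 1
  change algebraMap k (Slice k π u) c = toSlice k π u (algebraMap k R c)
  rw [AlgHom.commutes]

include hunit in
/-- **`S'₀` is étale over `R₀`** when `κ` is étale over `k`: `S₀ ≅ R₀ ⊗ₖ κ` is étale over `R₀`
and `S'₀ = S₀[1/s₀]`. [folklore] -/
theorem etale_sliceAway [Algebra.Etale k κ] :
    letI := sliceAwayZeroAlgebra 𝓡 π M b u hu s₀ hs₀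
    Algebra.Etale (𝓡 0) (sliceAwayPiece 𝓡 π M b u hu s₀ hs₀ 0) := by
  letI := zeroAlgebra 𝓡 π M b u hu
  letI := awayPieceZeroAlgebra (slicePiece k 𝓡 π M b u hu) hs₀ (Localization.Away s₀)
  letI := sliceAwayZeroAlgebra 𝓡 π M b u hu s₀ hs₀
  haveI : IsScalarTower (𝓡 0) (slicePiece k 𝓡 π M b u hu 0)
      (sliceAwayPiece 𝓡 π M b u hu s₀ hs₀ 0) :=
    IsScalarTower.of_algebraMap_eq fun _ => rfl
  haveI : Algebra.Etale (𝓡 0) (slicePiece k 𝓡 π M b u hu 0) := etale_zero 𝓡 π M b u hu hunit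
  haveI : Algebra.Etale (slicePiece k 𝓡 π M b u hu 0) (sliceAwayPiece 𝓡 π M b u hu s₀ hs₀ 0) :=
    haveI := isLocalization_awayPiece_zero (slicePiece k 𝓡 π M b u hu) hs₀ (Localization.Away s₀)
    Algebra.Etale.of_isLocalizationAway (⟨s₀, hs₀⟩ : slicePiece k 𝓡 π M b u hu 0)
  exact Algebra.Etale.comp (𝓡 0) (slicePiece k 𝓡 π M b u hu 0)
    (sliceAwayPiece 𝓡 π M b u hu s₀ hs₀ 0)

/-! ## The base point in `D(s₀)` and the prime of `S'₀` under it -/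

variable (h₀ : sliceEval π u s₀ ≠ 0)

/-- The base point survives in `D(s₀)` (`s₀` does not vanish at it): the evaluation
`S[1/s₀] → κ`. [folklore] -/
noncomputable def sliceAwayEval : Localization.Away s₀ →ₐ[k] κ :=
  IsLocalization.Away.liftAlgHom s₀ (f := sliceEval π u) (isUnit_iff_ne_zero.2 h₀)

omit [DecidableEq G] in
/-- The evaluation on `S[1/s₀]` extends the evaluation on `S`. [folklore] -/
theorem sliceAwayEval_algebraMap (x : Slice k π u) :
    sliceAwayEval π u s₀ h₀ (algebraMap (Slice k π u) (Localization.Away s₀) x) =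
      sliceEval π u x :=
  IsLocalization.Away.lift_eq s₀ (isUnit_iff_ne_zero.2 h₀) x

/-- **The prime `t'` of `S'₀` under the base point**: the kernel of `S'₀ → S' → κ`. [folklore] -/
noncomputable def sliceAwayPrime : Ideal (sliceAwayPiece 𝓡 π M b u hu s₀ hs₀ 0) :=
  RingHom.ker ((sliceAwayEval π u s₀ h₀).toRingHom.comp
    (algebraMap (sliceAwayPiece 𝓡 π M b u hu s₀ hs₀ 0) (Localization.Away s₀)))

/-- Membership in `t'`. [folklore] -/
theorem mem_sliceAwayPrime_iff (z : sliceAwayPiece 𝓡 π M b u hu s₀ hs₀ 0) :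
    z ∈ sliceAwayPrime 𝓡 π M b u hu s₀ hs₀ h₀ ↔
      sliceAwayEval π u s₀ h₀ (z : Localization.Away s₀) = 0 :=
  RingHom.mem_ker

/-- `t'` is prime (`κ` is a field). [folklore] -/
instance sliceAwayPrime.isPrime : (sliceAwayPrime 𝓡 π M b u hu s₀ hs₀ h₀).IsPrime :=
  RingHom.ker_isPrime _

/-- **`t'` lies over the image of the closed point in `Spec R₀`**: for `r ∈ R₀`, the image of `r`
in `S'₀` lies in `t'` iff `π r = 0`. [folklore] -/
theorem algebraMap_mem_sliceAwayPrime_iff (r : 𝓡 0) :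
    letI := sliceAwayZeroAlgebra 𝓡 π M b u hu s₀ hs₀
    algebraMap (𝓡 0) (sliceAwayPiece 𝓡 π M b u hu s₀ hs₀ 0) r ∈
        sliceAwayPrime 𝓡 π M b u hu s₀ hs₀ h₀ ↔ π r = 0 := by
  rw [mem_sliceAwayPrime_iff, coe_algebraMap_sliceAway, sliceAwayEval_algebraMap, sliceEval_toSlice]

/-- The localisation of `t` at `s₀` is contained in `t'`: elements of `t` map into `t'`.
[folklore] -/
theorem awayPieceZeroHom_mem_sliceAwayPrime {z : slicePiece k 𝓡 π M b u hu 0}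
    (hz : z ∈ slicePrimeZero 𝓡 π M b u hu) :
    awayPieceZeroHom (slicePiece k 𝓡 π M b u hu) hs₀ (Localization.Away s₀) z ∈
      sliceAwayPrime 𝓡 π M b u hu s₀ hs₀ h₀ := by
  rw [mem_sliceAwayPrime_iff]
  change sliceAwayEval π u s₀ h₀ (algebraMap (Slice k π u) (Localization.Away s₀) z) = 0
  rw [sliceAwayEval_algebraMap]
  exact (mem_slicePrimeZero_iff 𝓡 π M b u hu z).1 hz

end Setting

/-! ## Registered form -/

/-- **Registered sub-goal `stub_qs_sliceAway`** of the crux (helper of the stub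
`stub_qs_sliceCore`): the prime of `S[1/s₀]₀` under the base point contains the image of the
prime of `S₀` under it. [folklore] -/
theorem stub_qs_sliceAway :
    ∀ {k : Type} [Field k] {R : Type} [CommRing R] [Algebra k R] {G : Type} [AddCommGroup G]
      [DecidableEq G] (𝓡 : G → Submodule k R) [GradedAlgebra 𝓡] {κ : Type} [Field κ] [Algebra k κ]
      (π : R →ₐ[k] κ) (M : Submodule ℤ G) {m : ℕ} (b : Module.Basis (Fin m) ℤ M) (u : Fin m → R) (hu
      : ∀ l, u l ∈ 𝓡 (b l)) [DecidableEq (G ⧸ M)] (s₀ :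
      Summit.ResolutionOfSingularities.ResolutionOfSingularities.Theorems.DatumToEmbedded.QuotientSingularities.Slice
      k π u) (hs₀ : s₀ ∈
      Summit.ResolutionOfSingularities.ResolutionOfSingularities.Theorems.DatumToEmbedded.QuotientSingularities.slicePiece
      k 𝓡 π M b u hu 0) (h₀ :
      Summit.ResolutionOfSingularities.ResolutionOfSingularities.Theorems.DatumToEmbedded.QuotientSingularities.sliceEval
      π u s₀ ≠ 0) {z :
      ↥(Summit.ResolutionOfSingularities.ResolutionOfSingularities.Theorems.DatumToEmbedded.QuotientSingularities.slicePiece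
      k 𝓡 π M b u hu 0)}, z ∈
      Summit.ResolutionOfSingularities.ResolutionOfSingularities.Theorems.DatumToEmbedded.QuotientSingularities.slicePrimeZero
      𝓡 π M b u hu →
      Summit.ResolutionOfSingularities.ResolutionOfSingularities.Theorems.DatumToEmbedded.QuotientSingularities.awayPieceZeroHom
      (Summit.ResolutionOfSingularities.ResolutionOfSingularities.Theorems.DatumToEmbedded.QuotientSingularities.slicePiece
      k 𝓡 π M b u hu) hs₀ (Localization.Away s₀) z ∈
      Summit.ResolutionOfSingularities.ResolutionOfSingularities.Theorems.DatumToEmbedded.QuotientSingularities.sliceAwayPrime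
      𝓡 π M b u hu s₀ hs₀ h₀ := by
  intro k _ R _ _ G _ _ 𝓡 _ κ _ _ π M m b u hu _ s₀ hs₀ h₀ z hz
  exact awayPieceZeroHom_mem_sliceAwayPrime 𝓡 π M b u hu s₀ hs₀ h₀ hz

end Summit.ResolutionOfSingularities.ResolutionOfSingularities.Theorems.DatumToEmbedded.QuotientSingularities
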